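import Literature.Probability.LatticeModels.OnsagerYang
import Literature.Probability.LatticeModels.IsingPeierls
import Literature.Probability.LatticeModels.HighDimTrivialityWickProofs
import Literature.Barriers.CriticalPhenomena.PositionSpaceRGNonGibbsianIsraelDedecoration
import Literature.Barriers.CriticalPhenomena.PositionSpaceRGNonGibbsianThm41Step3
import HarnessLib

/-!
# Israel's example (van Enter–Fernández–Sokal 1993, §4.1.2): Step 2 — the magnetisation of the
# reduced system from the spontaneous magnetisation of the dedecorated model; Theorem 4.1 from
# Onsager's critical temperature

Final companion file of the Theorem 4.1 chain. Step 2 for the reduced system (`VEFS1993_eq46_reduced`,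
the only remaining named fact of `PositionSpaceRGNonGibbsianThm41Step3.lean`) is PROVED from the
positivity of the spontaneous magnetisation of the two-dimensional Ising model above the
self-dual point: by the dedecoration (`isingExpect_cut_spinAt_midOf`, eq. (4.6)) the magnetisation
of the internal spin `(1,0)` in the reduced system is `½ tanh 2β (⟨σ_{(1,1)}⟩ + ⟨σ_{(1,-1)}⟩)` in the
dedecorated `+`-boundary system of the centres, i.e. (transport along `centerEmb`) in the
`+`-boundary nearest-neighbour model on the rescaled box `[-(n+1), n]²` at coupling
`J' = ½ log cosh 2β`, whose one-point functions dominate the spontaneous magnetisation `M₀(J')`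
(Griffiths: shrinking the volume raises `+` correlations, `isingCorr_plus_le_of_subset`, and
`plusCorr_le_isingCorr_plus_box`, `plusCorr_singleton_eq_spontaneousMagnetization`) — "As `R → ∞`
this system tends to the `+` phase for an Ising model with coupling `J'`. In particular, the
magnetization … tends to the spontaneous magnetization `M₀(J')`, which is `> 0` if `J' > J_c`"
(p. 97; here the finite-volume inequality holds for every `R`, so `n₀ = 0`). Finally `J' > J_c =
½ log(1+√2)` iff `β > ½ cosh⁻¹(1+√2)` (Step 1), and `M₀(J') > 0` for `J' > β_c(2) = ½ log(1+√2)` is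
Onsager's critical temperature, the tree's named fact `criticalBeta_two` (with Peierls'
`exists_spontaneousMagnetization_pos_holds` and GKS monotonicity `spontaneousMagnetization_mono_holds`).

## What is formalised (namespace `Literature.Barriers.CriticalPhenomena.NonGibbs`)

`criticalBetaTwo_lt_decorK` (Step 1: `J' = PairIsing.decorK J > J_c ⟺ J > ½cosh⁻¹(1+√2)`),
`spontaneousMagnetization_le_isingExpect_oddGraph` (the finite-volume `+` magnetisation of the
dedecorated system dominates `M₀(J')`), `tanh_mul_spontaneousMagnetization_le_isingExpect_cut`,
`VEFS1993_eq46_reduced_of_magnetization_pos`, `spontaneousMagnetization_pos_of_criticalBeta_two`,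
and the final assemblies `VEFS1993_eq46_reduced_of_criticalBeta_two`,
`VEFS1993_thm41_of_criticalBeta_two : criticalBeta_two → VEFS1993_thm41`, `VEFS1993_thm41_of_onsager_yang`.
All proved; no new named facts. Since the tree PROVES the Onsager–Yang formula
(`onsager_yang_of_tree`, `HighDimTrivialityWickProofs.lean`: Wu's Toeplitz-determinant asymptotics
`toeplitzDet_onsagerSymbol_exp_decay_holds` fed into `onsager_yang_of_wu`), the chain closes
unconditionally: the discharges `VEFS1993_eq46_reduced_holds`, `VEFS1993_eq413_israel_holds` and
**`VEFS1993_thm41_holds : VEFS1993_thm41`** (standard axioms only).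
-/

noncomputable section

namespace Literature.Barriers.CriticalPhenomena.NonGibbs

open Finset Literature.Probability.LatticeModels Literature.Probability.LatticeModels.AEdge

/-! ### Step 1: the effective coupling crosses `J_c` exactly at `½ cosh⁻¹(1+√2)` -/

/-- **Step 1**: "If `J' > J_c = ½ log(1+√2)`, that is, `J > ½ cosh⁻¹(1+√2) = 0.764285…`" — for
`β > israelThreshold`, the effective coupling exceeds the critical coupling of the square lattice:
`J' = PairIsing.decorK β = ½ log cosh 2β > ½ log(1+√2) = criticalBetaTwo`. [cite: VanenterFernandezSokal1993, §4.1.2 Step 1] -/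
theorem criticalBetaTwo_lt_decorK {β : ℝ} (hβ : israelThreshold < β) :
    criticalBetaTwo < PairIsing.decorK β := by
  have h0 : 0 < israelThreshold := israelThreshold_pos
  have hcosh : 1 + Real.sqrt 2 < Real.cosh (2 * β) := by
    rw [← cosh_two_mul_israelThreshold, Real.cosh_lt_cosh, abs_of_pos (by linarith),
      abs_of_pos (by linarith)]
    linarith
  unfold PairIsing.decorK criticalBetaTwo
  have hpos : 0 < 1 + Real.sqrt 2 := by positivity
  linarith [Real.log_lt_log hpos hcosh]

/-! ### Step 2: the `+` magnetisation of the dedecorated system dominates `M₀(J')` -/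

/-- The rescaled box `[-(n+1), n]²` lies in the centred box `Λ_{n+1}`. [cite: VanenterFernandezSokal1993, §4.1.2 Step 2] -/
theorem rescaledBox_subset_box (n : ℕ) : rescaledBox n ⊆ box 2 (n + 1) := by
  intro x hx
  rw [mem_rescaledBox] at hx
  rw [mem_box]
  intro k
  have := hx k
  push_cast
  omega

/-- **The finite-volume `+` magnetisation of the dedecorated system dominates `M₀(J')`**: for a
centre `centerEmb x` of the box (`x` in the rescaled box) and `J' ≥ 0`,
`M₀(J') ≤ ⟨σ_{centerEmb x}⟩^{+}_{oddGraph; centres; J'}` — transport to the `+`-boundary model on the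
rescaled box (`isingExpect_oddGraph_map_spinAt`), Griffiths' monotonicity in the volume
(`isingCorr_plus_le_of_subset`, the rescaled box inside `Λ_{n+1}`) and
`⟨σ_x⟩⁺_{Λ_{n+1}} ≥ ⟨σ_x⟩⁺ = M₀` (`plusCorr_le_isingCorr_plus_box`,
`plusCorr_singleton_eq_spontaneousMagnetization`): "this system tends to the `+` phase for an Ising
model with coupling `J'` … the magnetization … tends to the spontaneous magnetization `M₀(J')`".
[cite: VanenterFernandezSokal1993, §4.1.2 Step 2, Figure 4(e)] -/
theorem spontaneousMagnetization_le_isingExpect_oddGraph {n : ℕ} {J : ℝ} (hJ : 0 ≤ J) {x : Site 2}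
    (hx : x ∈ rescaledBox n) :
    spontaneousMagnetization 2 J ≤ isingExpect oddGraph (centerFinset n) J 0 .plus (spinAt (centerEmb x)) := by
  rw [centerFinset_eq_map, isingExpect_oddGraph_map_spinAt]
  have hsp : spinProduct ({x} : Finset (Site 2)) = spinAt x := by funext σ; simp [spinProduct]
  have h1 : isingExpect (zdGraph 2) (rescaledBox n) J 0 .plus (spinAt x) =
      isingCorr (zdGraph 2) (rescaledBox n) J 0 .plus {x} := by rw [isingCorr, isingExpect, hsp]; rfl
  rw [h1, ← plusCorr_singleton_eq_spontaneousMagnetization hJ x]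
  have hxb : ({x} : Finset (Site 2)) ⊆ box 2 (n + 1) :=
    Finset.singleton_subset_iff.2 (rescaledBox_subset_box n hx)
  exact (plusCorr_le_isingCorr_plus_box hJ le_rfl hxb).trans
    (isingCorr_plus_le_of_subset (zdGraph 2) hJ le_rfl (Finset.singleton_subset_iff.2 hx)
      (rescaledBox_subset_box n))

/-- The internal spin `(1,0) = e₀` adjacent to the origin is the midpoint of the bond from `(0,-1)`
upwards in the rescaled lattice; its centres are `(1,1) = centerEmb (0,0)` and `(1,-1) = centerEmb (0,-1)`.
[cite: VanenterFernandezSokal1993, §4.1.2 Step 3] -/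
theorem vec_zero_eq_midOf : vec 0 = midOf ((fun k : Fin 2 => if k = 0 then (0 : ℤ) else -1), 1) := by
  refine funext (Fin.forall_fin_two.2 ⟨?_, ?_⟩)
  · rw [midOf_apply_ne _ (show (0 : Fin 2) ≠ 1 by decide)]; simp
  · rw [show midOf ((fun k : Fin 2 => if k = 0 then (0 : ℤ) else -1), 1) 1 =
      2 * (fun k : Fin 2 => if k = 0 then (0 : ℤ) else -1) 1 + 2 from midOf_apply_same _]
    simp

/-- The anchor `(0,-1)` of that bond lies in every rescaled box. [cite: VanenterFernandezSokal1993, §4.1.2 Step 2] -/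
theorem anchor_mem_rescaledBox (n : ℕ) :
    (fun k : Fin 2 => if k = 0 then (0 : ℤ) else -1) ∈ rescaledBox n := by
  rw [mem_rescaledBox]; intro k; fin_cases k <;> simp

/-- Its tip `(0,0)` lies in every rescaled box. [cite: VanenterFernandezSokal1993, §4.1.2 Step 2] -/
theorem tip_anchor_mem_rescaledBox (n : ℕ) :
    tip ((fun k : Fin 2 => if k = 0 then (0 : ℤ) else -1), 1) ∈ rescaledBox n := by
  rw [mem_rescaledBox]; intro k; fin_cases k <;> simp [tip, vec]

/-- **Step 2 for the reduced system, quantitatively**: for `β ≥ 0` and every `n`,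
`tanh 2β · M₀(J') ≤ ⟨σ_{1,0}⟩_{Q_n}` — eq. (4.6) (`isingExpect_cut_spinAt_midOf`) and the domination
of the two centre magnetisations by `M₀(J')`. [cite: VanenterFernandezSokal1993, §4.1.2 Step 2 eq. (4.6)] -/
theorem tanh_mul_spontaneousMagnetization_le_isingExpect_cut {β : ℝ} (hβ : 0 ≤ β) (n : ℕ) :
    Real.tanh (2 * β) * spontaneousMagnetization 2 (PairIsing.decorK β) ≤
      isingExpect (cutGraph n) (internalVolume n) β 0 .plus (spinAt (vec 0)) := by
  have hε : ((fun k : Fin 2 => if k = 0 then (0 : ℤ) else -1), (1 : Fin 2)) ∈ anchT (rescaledBox n) :=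
    mem_anchT.2 (Or.inl (anchor_mem_rescaledBox n))
  rw [vec_zero_eq_midOf, isingExpect_cut_spinAt_midOf β hε]
  have ht : 0 ≤ Real.tanh (2 * β) := by
    rw [Real.tanh_eq_sinh_div_cosh]
    exact div_nonneg (Real.sinh_nonneg_iff.2 (by linarith)) (Real.cosh_pos _).le
  have h1 := spontaneousMagnetization_le_isingExpect_oddGraph (PairIsing.decorK_nonneg β)
    (tip_anchor_mem_rescaledBox n)
  have h2 := spontaneousMagnetization_le_isingExpect_oddGraph (PairIsing.decorK_nonneg β)
    (anchor_mem_rescaledBox n)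
  nlinarith

/-- **`VEFS1993_eq46_reduced` from the positivity of the spontaneous magnetisation above the
self-dual point**: if `M₀(J') > 0` for all `J' > ½ log(1+√2)`, then Step 2 holds with
`m = tanh 2β · M₀(J')` and `n₀ = 0`. [cite: VanenterFernandezSokal1993, §4.1.2 Steps 1–2] -/
theorem VEFS1993_eq46_reduced_of_magnetization_pos
    (hM : ∀ J : ℝ, criticalBetaTwo < J → 0 < spontaneousMagnetization 2 J) : VEFS1993_eq46_reduced := by
  intro β hβ
  have hβpos : 0 < β := israelThreshold_pos.trans hβ
  have ht : 0 < Real.tanh (2 * β) := by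
    rw [Real.tanh_eq_sinh_div_cosh]
    exact div_pos (Real.sinh_pos_iff.2 (by linarith)) (Real.cosh_pos _)
  refine ⟨Real.tanh (2 * β) * spontaneousMagnetization 2 (PairIsing.decorK β),
    mul_pos ht (hM _ (criticalBetaTwo_lt_decorK hβ)), 0, fun n _ => ?_⟩
  exact tanh_mul_spontaneousMagnetization_le_isingExpect_cut hβpos.le n

/-! ### Onsager's critical temperature and the final assembly -/

/-- **`M₀(J) > 0` for `J > β_c(2) = ½ log(1+√2)`** from the tree's named fact `criticalBeta_two`
(Onsager / Kramers–Wannier), Peierls' theorem (`exists_spontaneousMagnetization_pos_holds`: the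
defining set of `β_c(2)` is nonempty) and the GKS monotonicity of `M₀`
(`spontaneousMagnetization_mono_holds`). [cite: FriedliVelenik2017, Thm. 3.25 and §3.10.1] -/
theorem spontaneousMagnetization_pos_of_criticalBeta_two (hc : criticalBeta_two) {J : ℝ}
    (hJ : criticalBetaTwo < J) : 0 < spontaneousMagnetization 2 J := by
  rw [criticalBeta_two] at hc
  rw [← hc] at hJ
  have hne : {β : ℝ | 0 ≤ β ∧ 0 < spontaneousMagnetization 2 β}.Nonempty :=
    exists_spontaneousMagnetization_pos_holds (d := 2) (by norm_num)
  obtain ⟨a, ⟨ha0, hapos⟩, haJ⟩ := exists_lt_of_csInf_lt hne hJ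
  exact hapos.trans_le (spontaneousMagnetization_mono_holds (d := 2) ha0 (ha0.trans haJ.le) haJ.le)

/-- **Step 2 for the reduced system from Onsager's critical temperature.**
[cite: VanenterFernandezSokal1993, §4.1.2 Steps 1–2] -/
theorem VEFS1993_eq46_reduced_of_criticalBeta_two (hc : criticalBeta_two) : VEFS1993_eq46_reduced :=
  VEFS1993_eq46_reduced_of_magnetization_pos fun _ hJ => spontaneousMagnetization_pos_of_criticalBeta_two hc hJ

/-- **van Enter–Fernández–Sokal's Theorem 4.1 from Onsager's critical temperature.** The whole
chain is proved — Step 0 and the Conclusion (`PositionSpaceRGNonGibbsianSpacing/Thm41`), Step 3 and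
the FKG comparison (`Thm41Step3`, `IsraelComparison`), the dedecoration of Steps 1–2
(`IsraelDedecoration`) — so that Theorem 4.1 (`VEFS1993_thm41`: for `β > ½ cosh⁻¹(1+√2)` the `b = 2`
decimation of every zero-field Gibbs measure of the two-dimensional Ising model is consistent with
no quasilocal specification) rests on the single named fact `criticalBeta_two`
(`β_c(2) = ½ log(1+√2)`, Onsager 1944 / Kramers–Wannier). [cite: VanenterFernandezSokal1993, Theorem 4.1] -/
theorem VEFS1993_thm41_of_criticalBeta_two (hc : criticalBeta_two) : VEFS1993_thm41 :=
  VEFS1993_thm41_of_eq46 (VEFS1993_eq46_reduced_of_criticalBeta_two hc)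

/-- The same from the Onsager–Yang formula (`onsager_yang`, which implies `criticalBeta_two`).
[cite: VanenterFernandezSokal1993, Theorem 4.1] -/
theorem VEFS1993_thm41_of_onsager_yang (h : onsager_yang) : VEFS1993_thm41 :=
  VEFS1993_thm41_of_criticalBeta_two (criticalBeta_two_of_onsager_yang h)

/-! ### Unconditionally: the Onsager–Yang formula is proved in the tree -/

/-- **Step 2 for the reduced system, unconditionally** — the discharge of the named fact
`VEFS1993_eq46_reduced`: the tree proves the Onsager–Yang formula (`onsager_yang_of_tree`), hence
`β_c(2) = ½ log(1+√2)` (`criticalBeta_two_of_onsager_yang`) and `M₀(J') > 0` for `J' > J_c`.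
[cite: VanenterFernandezSokal1993, §4.1.2 Step 2 eq. (4.6)] -/
theorem VEFS1993_eq46_reduced_holds : VEFS1993_eq46_reduced :=
  VEFS1993_eq46_reduced_of_criticalBeta_two (criticalBeta_two_of_onsager_yang onsager_yang_of_tree)

/-- **The finite-volume estimate (4.3)–(4.5)/(4.13) of Israel's example, unconditionally** — the
discharge of the named fact `VEFS1993_eq413_israel`. [cite: VanenterFernandezSokal1993, §4.1.2 Step 3 eq. (4.13)] -/
theorem VEFS1993_eq413_israel_holds : VEFS1993_eq413_israel :=
  VEFS1993_eq413_israel_of_eq46 VEFS1993_eq46_reduced_holds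

/-- **van Enter–Fernández–Sokal 1993, Theorem 4.1, proved.** "Let `d = 2`, `h = 0` and
`J > ½ cosh⁻¹(1+√2) = 0.764285…`, and let `μ` be any Gibbs measure for the two-dimensional Ising
model [with nearest-neighbor Hamiltonian]. Let `T` be the decimation transformation with spacing
`b = 2`. Then the measure `μT` is not consistent with any quasilocal specification. In particular,
it is not the Gibbs measure for any uniformly convergent interaction." The discharge of the named
fact `VEFS1993_thm41`: Step 0 and the Conclusion (`PositionSpaceRGNonGibbsianSpacing`, `…Thm41`),
the FKG comparison and Step 3 (`…IsraelComparison`, `…Thm41Step3`), the dedecoration of Steps 1–2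
(`…IsraelDedecoration`, this file) and Onsager's critical temperature (`onsager_yang_of_tree`).
[cite: VanenterFernandezSokal1993, Theorem 4.1] -/
theorem VEFS1993_thm41_holds : VEFS1993_thm41 :=
  VEFS1993_thm41_of_onsager_yang onsager_yang_of_tree

end Literature.Barriers.CriticalPhenomena.NonGibbs

end
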